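import Literature.MathematicalPhysics.QuantumFieldTheory.ConformalBootstrap3D.BlockDiagonalEnclosureAB
import HarnessLib

/-!
# Named fact: the equal-external-dimension scalar 3D block on the diagonal in closed form
# (El-Showk–Paulos–Poland–Rychkov–Simmons-Duffin–Vichi 2012, App. B), and its alternating-series enclosure

For four identical external scalars (`Δ₁₂ = Δ₃₄ = 0`) and scalar exchange (`ℓ = 0`) in `d = 3`
(`α = d/2 − 1 = 1/2`), El-Showk et al. derive from Dolan–Osborn's double power series (DO1 eq. (2.32))
the single series on the diagonal `z = z̄`:

  `G_{Δ,0}(z = z̄) = (z²/(1−z))^{Δ/2} Σ_{n ≥ 0} c_n(Δ) (z²/(z−1))^n`,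
  `c_n(Δ) = [(Δ/2)_n]³ (Δ/2 − α)_n / (n! (Δ)_{2n} (Δ − α)_n) = Π_{i<n} ρ_i(Δ)`,
  `ρ_i(Δ) = (Δ/2 + i)³ (Δ/2 − ½ + i) / ((i+1)(Δ + 2i)(Δ + 2i + 1)(Δ − ½ + i))`

(a `₃F₂(Δ/2, Δ/2, Δ/2 − α; (Δ+1)/2, Δ − α; z²/(4(z−1)))` after the duplication formula
`(Δ)_{2n} = 4^n (Δ/2)_n ((Δ+1)/2)_n`); its argument is NEGATIVE on `(0,1)`, so the series ALTERNATES,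
and it converges for `z² < 4(1 − z)`.
[cite: ElshowkEtAl2012, App. B (the displayed series "So we get", recognised as eq. (3F2-0))]

Section 1 records the statement as a NAMED FACT (`ElShowkDiagonalClosedForm`, a `Prop`-valued definition
with its cite tag, used downstream as a hypothesis), phrased over the tree's diagonal series
`Σ_n a_n(0,0; Δ, 0) y^{Δ+n}` (`hrDiagCoeffAB`; Dolan–Osborn 2004 §3 in Hogervorst–Rychkov normalisation,
leading coefficient `a_0 = 1/λ_0 = 1`), which is the diagonal value `g(y,y)` of ANY
`IsConformalBlock3D 0 0 Δ 0 g` (`IsConformalBlock3D.diag_eq_tsum_of_neg_eq`). NORMALISATION CHECK (recorded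
here, not formalised): both sides equal `y^Δ (1 + (Δ/2) y + Δ(Δ³+2Δ²+Δ−1)/(4(Δ+1)(2Δ−1)) y² + O(y³))`
identically in `Δ` — ours from the recursion (`A_{1,1} = Δ/2`, `A_{2,0} + A_{2,2} =
Δ(Δ−1)²/(12(2Δ−1)) + Δ(Δ+2)²/(12(Δ+1))`), theirs from `(1−y)^{−Δ/2}(1 − c_1 y²(1−y)^{−1} + …)`,
`c_1 = ρ_0 = Δ²(Δ−1)/(8(Δ+1)(2Δ−1))`; with the common Casimir eigen-equation this identifies the two
normalisations. NUMERICAL CROSS-CHECK (recorded, not formalised): the closed form with the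
product-form coefficients below agrees with the Dolan–Osborn double series
`Σ_m ((Δ/2)_m)^4/(m!(Δ)_{2m}(Δ−½)_m) u^{Δ/2+m} ₂F₁(m+Δ/2, m+Δ/2; 2m+Δ; 1−v)` (DO1 eq. (2.32) summed
in `n`; App. B, first display) at `u = y²`, `v = (1−y)²` to relative deviation `≤ 2·10⁻¹⁵` for
`(Δ, y) ∈ {1.2, 1.51, 2, 3.3} × {0.2, 0.5, 0.75}` (double precision). Hypotheses kept: `Δ` strictly
above the scalar unitarity bound and `Δ ≠ 1` (the hypotheses under which the tree's `z`-series layer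
`BlockZSeriesABGeneral` identifies the recursion-defined coefficients with the block at `ℓ = 0`; at
`Δ = 1` the closed form degenerates to the free value `(z²/(1−z))^{1/2}`), and `y² < 4(1−y)`.

Section 2 is elementary and PROVED: for `1 ≤ Δ ≤ 2` every ratio satisfies `ρ_n(Δ) ≤ 1/4`
(`esDiagRatio_le_quarter`), so inside the radius (`y²/(1−y) < 4`) the unsigned terms
`e_n = c_n (y²/(1−y))^n` are non-negative and ANTITONE (`esDiagTerm_succ_le`, `antitone_esDiagTerm`);
hence, GIVEN the fact, the diagonal series is enclosed between consecutive partial sums of the alternating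
series (Leibniz; Mathlib `Antitone.alternating_series_le_tendsto` / `tendsto_le_alternating_series`):
`diag_tsum_mem_Icc_of_elShowk`. This is the closed-form source of the ONE number `U ≥ D(0; y')` that the
diagonal/point enclosures of the tree take as a hypothesis, for exchanged dimensions in `(1, 2]`.

NON-CLAIMS. No hypergeometric identity is formalised (Section 1 is a hypothesis); Section 2 proves only
the sign/monotonicity of the terms and the Leibniz enclosure GIVEN Section 1; no number is evaluated. No
claim for unequal external dimensions — El-Showk et al. note that a closed form for `Δ₁₂ = Δ₃₄ ≠ 0`
"may be difficult" (App. B) — nor for `Δ > 2` (where `ρ_n ≤ 1/4` needs `n` large). The file introduces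
definitions (`esDiagRatio`, `esDiagCoeff`, `esDiagTerm`, the fact) with theorems; it is filed as kind
`definition`. [cite: ElshowkEtAl2012, App. B]
-/

noncomputable section

namespace Literature.MathematicalPhysics.QuantumFieldTheory.ConformalBootstrap3D

open Set Finset Filter Topology

/-! ## 1. The closed form as a named fact -/

/-- The term ratio `ρ_i(Δ) = (Δ/2 + i)³ (Δ/2 − ½ + i) / ((i+1)(Δ + 2i)(Δ + 2i + 1)(Δ − ½ + i))` of
El-Showk et al.'s diagonal series (`c_{i+1}/c_i`; Pochhammer ratios with `(Δ)_{2i+2}/(Δ)_{2i} =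
(Δ+2i)(Δ+2i+1)`). [cite: ElshowkEtAl2012, App. B] -/
def esDiagRatio (Δ : ℝ) (i : ℕ) : ℝ :=
  (Δ / 2 + i) ^ 3 * (Δ / 2 - 1 / 2 + i) / (((i : ℝ) + 1) * (Δ + 2 * i) * (Δ + 2 * i + 1) * (Δ - 1 / 2 + i))

/-- El-Showk et al.'s series coefficient at `d = 3` in product form,
`c_n(Δ) = [(Δ/2)_n]³ (Δ/2 − 1/2)_n / (n! (Δ)_{2n} (Δ − 1/2)_n) = Π_{i<n} ρ_i(Δ)`. [cite: ElshowkEtAl2012, App. B] -/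
def esDiagCoeff (Δ : ℝ) (n : ℕ) : ℝ := ∏ i ∈ range n, esDiagRatio Δ i

/-- The `n`-th unsigned term of the alternating diagonal series at `y`: `e_n(Δ; y) = c_n(Δ) (y²/(1−y))^n`.
[cite: ElshowkEtAl2012, App. B] -/
def esDiagTerm (Δ y : ℝ) (n : ℕ) : ℝ := esDiagCoeff Δ n * (y ^ 2 / (1 - y)) ^ n

/-- **NAMED FACT (El-Showk et al. 2012, App. B).** For `Δ` strictly above the scalar unitarity bound,
`Δ ≠ 1`, and `y ∈ (0,1)` with `y² < 4(1−y)`: the alternating series `Σ (−1)^n e_n(Δ; y)` is summable and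
the Dolan–Osborn diagonal series `Σ_n a_n(0,0;Δ,0) y^{Δ+n}` equals `(y²/(1−y))^{Δ/2}` times its sum.
[cite: ElshowkEtAl2012, App. B (series form of eq. (3F2-0))] [cite: DolanOsborn2004, §3 eqs. (3.10)–(3.11)] -/
def ElShowkDiagonalClosedForm : Prop :=
  ∀ Δ : ℝ, unitarityBound3D 0 < Δ → Δ ≠ 1 → ∀ y : ℝ, y ∈ Ioo (0 : ℝ) 1 → y ^ 2 < 4 * (1 - y) →
    Summable (fun n : ℕ => (-1 : ℝ) ^ n * esDiagTerm Δ y n) ∧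
      ∑' n : ℕ, hrDiagCoeffAB 0 0 Δ 0 n * y ^ (Δ + (n : ℝ)) =
        (y ^ 2 / (1 - y)) ^ (Δ / 2) * ∑' n : ℕ, (-1 : ℝ) ^ n * esDiagTerm Δ y n

/-! ## 2. Sign and monotonicity of the terms; the Leibniz enclosure -/

/-- `ρ_i(Δ) ≥ 0` for `Δ ≥ 1`. [cite: ElshowkEtAl2012, App. B] -/
theorem esDiagRatio_nonneg {Δ : ℝ} (hΔ : 1 ≤ Δ) (i : ℕ) : 0 ≤ esDiagRatio Δ i := by
  unfold esDiagRatio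
  have hi : (0 : ℝ) ≤ i := Nat.cast_nonneg i
  apply div_nonneg
  · exact mul_nonneg (pow_nonneg (by linarith) 3) (by linarith)
  · have h1 : 0 ≤ (i : ℝ) + 1 := by linarith
    have h2 : 0 ≤ Δ + 2 * i := by linarith
    have h3 : 0 ≤ Δ + 2 * i + 1 := by linarith
    have h4 : 0 ≤ Δ - 1 / 2 + i := by linarith
    exact mul_nonneg (mul_nonneg (mul_nonneg h1 h2) h3) h4

/-- **`ρ_i(Δ) ≤ 1/4` for `1 ≤ Δ ≤ 2`**: `4(Δ/2+i)³(Δ/2−½+i) = (Δ+2i)³(Δ−1+2i)/4` and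
`(Δ+2i)² ≤ 2(i+1)(Δ+2i+1)` (from `Δ ≤ 2`), `Δ−1+2i ≤ 2Δ−1+2i`. [cite: ElshowkEtAl2012, App. B] -/
theorem esDiagRatio_le_quarter {Δ : ℝ} (hΔ1 : 1 ≤ Δ) (hΔ2 : Δ ≤ 2) (i : ℕ) : esDiagRatio Δ i ≤ 1 / 4 := by
  unfold esDiagRatio
  have hi : (0 : ℝ) ≤ i := Nat.cast_nonneg i
  have hden : 0 < ((i : ℝ) + 1) * (Δ + 2 * i) * (Δ + 2 * i + 1) * (Δ - 1 / 2 + i) := by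
    have h1 : 0 < (i : ℝ) + 1 := by linarith
    have h2 : 0 < Δ + 2 * i := by linarith
    have h3 : 0 < Δ + 2 * i + 1 := by linarith
    have h4 : 0 < Δ - 1 / 2 + i := by linarith
    positivity
  rw [div_le_iff₀ hden]
  -- (Δ/2+i)³(Δ/2−½+i) = (Δ+2i)³(Δ−1+2i)/16 ≤ ¼ (i+1)(Δ+2i)(Δ+2i+1)(Δ−½+i)
  have hA : 0 ≤ Δ + 2 * i := by linarith
  have hB : 0 ≤ Δ - 1 + 2 * i := by linarith
  have hsq : (Δ + 2 * i) ^ 2 ≤ 2 * ((i : ℝ) + 1) * (Δ + 2 * i + 1) := by nlinarith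
  have hlin : Δ - 1 + 2 * i ≤ 2 * Δ - 1 + 2 * i := by linarith
  have key : (Δ + 2 * i) ^ 3 * (Δ - 1 + 2 * i) ≤
      (Δ + 2 * i) * (2 * ((i : ℝ) + 1) * (Δ + 2 * i + 1)) * (2 * Δ - 1 + 2 * i) := by
    have := mul_le_mul (mul_le_mul_of_nonneg_left hsq hA) hlin hB (by positivity)
    nlinarith [this]
  have e1 : (Δ / 2 + i) ^ 3 * (Δ / 2 - 1 / 2 + i) = (Δ + 2 * i) ^ 3 * (Δ - 1 + 2 * i) / 16 := by ring
  have e2 : 1 / 4 * (((i : ℝ) + 1) * (Δ + 2 * i) * (Δ + 2 * i + 1) * (Δ - 1 / 2 + i)) =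
      (Δ + 2 * i) * (2 * ((i : ℝ) + 1) * (Δ + 2 * i + 1)) * (2 * Δ - 1 + 2 * i) / 16 := by ring
  rw [e1, e2]
  exact div_le_div_of_nonneg_right key (by norm_num)

/-- `c_n(Δ) ≥ 0` for `Δ ≥ 1`. [cite: ElshowkEtAl2012, App. B] -/
theorem esDiagCoeff_nonneg {Δ : ℝ} (hΔ : 1 ≤ Δ) (n : ℕ) : 0 ≤ esDiagCoeff Δ n :=
  prod_nonneg fun i _ => esDiagRatio_nonneg hΔ i

/-- `e_n(Δ; y) ≥ 0` for `Δ ≥ 1`, `y < 1`. [cite: ElshowkEtAl2012, App. B] -/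
theorem esDiagTerm_nonneg {Δ y : ℝ} (hΔ : 1 ≤ Δ) (hy : y < 1) (n : ℕ) : 0 ≤ esDiagTerm Δ y n :=
  mul_nonneg (esDiagCoeff_nonneg hΔ n) (pow_nonneg (div_nonneg (sq_nonneg y) (by linarith)) n)

/-- The recurrence `e_{n+1} = e_n · ρ_n · y²/(1−y)`. [cite: ElshowkEtAl2012, App. B] -/
theorem esDiagTerm_succ (Δ y : ℝ) (n : ℕ) :
    esDiagTerm Δ y (n + 1) = esDiagTerm Δ y n * (esDiagRatio Δ n * (y ^ 2 / (1 - y))) := by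
  unfold esDiagTerm esDiagCoeff
  rw [prod_range_succ, pow_succ]
  ring

/-- **Antitone terms inside the radius**: `e_{n+1} ≤ e_n` for `1 ≤ Δ ≤ 2`, `y < 1`, `y²/(1−y) ≤ 4`.
[cite: ElshowkEtAl2012, App. B] -/
theorem esDiagTerm_succ_le {Δ y : ℝ} (hΔ1 : 1 ≤ Δ) (hΔ2 : Δ ≤ 2) (hy : y < 1)
    (hw : y ^ 2 / (1 - y) ≤ 4) (n : ℕ) : esDiagTerm Δ y (n + 1) ≤ esDiagTerm Δ y n := by
  rw [esDiagTerm_succ]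
  have h0 := esDiagTerm_nonneg hΔ1 hy n
  have hρ := esDiagRatio_le_quarter hΔ1 hΔ2 n
  have hρ0 := esDiagRatio_nonneg hΔ1 n
  have hw0 : 0 ≤ y ^ 2 / (1 - y) := div_nonneg (sq_nonneg y) (by linarith)
  have h1 : esDiagRatio Δ n * (y ^ 2 / (1 - y)) ≤ 1 := by nlinarith
  calc esDiagTerm Δ y n * (esDiagRatio Δ n * (y ^ 2 / (1 - y)))
      ≤ esDiagTerm Δ y n * 1 := mul_le_mul_of_nonneg_left h1 h0
    _ = esDiagTerm Δ y n := mul_one _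

/-- Hence `n ↦ e_n(Δ; y)` is antitone (`1 ≤ Δ ≤ 2`, `y < 1`, `y²/(1−y) ≤ 4`). [cite: ElshowkEtAl2012, App. B] -/
theorem antitone_esDiagTerm {Δ y : ℝ} (hΔ1 : 1 ≤ Δ) (hΔ2 : Δ ≤ 2) (hy : y < 1)
    (hw : y ^ 2 / (1 - y) ≤ 4) : Antitone (esDiagTerm Δ y) :=
  antitone_nat_of_succ_le fun n => esDiagTerm_succ_le hΔ1 hΔ2 hy hw n

/-- The scalar unitarity bound is `1/2` (private helper). [cite: ElshowkEtAl2012, §2] -/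
private theorem unitarityBound3D_zero_eq' : unitarityBound3D 0 = 1 / 2 := by
  simp [unitarityBound3D]

/-- **Leibniz enclosure of the diagonal series, GIVEN the named fact.** For `1 < Δ ≤ 2`, `y ∈ (0,1)` with
`y² < 4(1−y)` and any `k`:
`(y²/(1−y))^{Δ/2} Σ_{i<2k} (−1)^i e_i ≤ Σ_n a_n(0,0;Δ,0) y^{Δ+n} ≤ (y²/(1−y))^{Δ/2} Σ_{i<2k+1} (−1)^i e_i`
— finitely many closed-form numbers on both sides. [cite: ElshowkEtAl2012, App. B]
[cite: DolanOsborn2004, §3 eqs. (3.10)–(3.11)] -/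
theorem diag_tsum_mem_Icc_of_elShowk (h : ElShowkDiagonalClosedForm) {Δ y : ℝ} (hΔ1 : 1 < Δ)
    (hΔ2 : Δ ≤ 2) (hy : y ∈ Ioo (0 : ℝ) 1) (hw : y ^ 2 < 4 * (1 - y)) (k : ℕ) :
    ∑' n : ℕ, hrDiagCoeffAB 0 0 Δ 0 n * y ^ (Δ + (n : ℝ)) ∈
      Set.Icc ((y ^ 2 / (1 - y)) ^ (Δ / 2) * ∑ i ∈ range (2 * k), (-1 : ℝ) ^ i * esDiagTerm Δ y i)
        ((y ^ 2 / (1 - y)) ^ (Δ / 2) * ∑ i ∈ range (2 * k + 1), (-1 : ℝ) ^ i * esDiagTerm Δ y i) := by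
  have hub : unitarityBound3D 0 < Δ := by rw [unitarityBound3D_zero_eq']; linarith
  obtain ⟨hs, heq⟩ := h Δ hub (by linarith) y hy hw
  have hy1 : 0 < 1 - y := by linarith [hy.2]
  have hw' : y ^ 2 / (1 - y) ≤ 4 := by rw [div_le_iff₀ hy1]; linarith
  have ha := antitone_esDiagTerm hΔ1.le hΔ2 hy.2 hw'
  have hfl := hs.hasSum.tendsto_sum_nat
  have hlo := ha.alternating_series_le_tendsto hfl k
  have hhi := ha.tendsto_le_alternating_series hfl k
  have hfac : 0 ≤ (y ^ 2 / (1 - y)) ^ (Δ / 2) := Real.rpow_nonneg (div_nonneg (sq_nonneg y) hy1.le) _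
  rw [heq]
  exact ⟨mul_le_mul_of_nonneg_left hlo hfac, mul_le_mul_of_nonneg_left hhi hfac⟩

/-- The same enclosure for the diagonal VALUE of any genuine block with equal external dimensions.
[cite: ElshowkEtAl2012, App. B] [cite: DolanOsborn2004, §3 eqs. (3.10)–(3.11)] -/
theorem IsConformalBlock3D.diag_mem_Icc_of_elShowk (h : ElShowkDiagonalClosedForm) {Δ : ℝ}
    {g : ℝ → ℝ → ℝ} (hΔ1 : 1 < Δ) (hΔ2 : Δ ≤ 2) (hreg : ¬ accidentalDegeneracy3D Δ 0)
    (hg : IsConformalBlock3D 0 0 Δ 0 g) {y : ℝ} (hy : y ∈ Ioo (0 : ℝ) 1) (hw : y ^ 2 < 4 * (1 - y))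
    (k : ℕ) :
    g y y ∈
      Set.Icc ((y ^ 2 / (1 - y)) ^ (Δ / 2) * ∑ i ∈ range (2 * k), (-1 : ℝ) ^ i * esDiagTerm Δ y i)
        ((y ^ 2 / (1 - y)) ^ (Δ / 2) * ∑ i ∈ range (2 * k + 1), (-1 : ℝ) ^ i * esDiagTerm Δ y i) := by
  have hub : unitarityBound3D 0 < Δ := by rw [unitarityBound3D_zero_eq']; linarith
  have e := hg.diag_eq_tsum_of_neg_eq hub hreg (by norm_num) hy
  rw [e]
  simpa using diag_tsum_mem_Icc_of_elShowk h hΔ1 hΔ2 hy hw k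

end Literature.MathematicalPhysics.QuantumFieldTheory.ConformalBootstrap3D

end
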